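import Summits.Ventures.Crystal3D.Theorems.StickyWulffConstantCoaxialWallLawHealCap
import HarnessLib

/-!
# HEAL-CAP, cap-table row «TEN′»: closed lower half-dozen PLUS ONE HCP CAPPER occupied — at most ONE further contact off the two other hcp tips
# (crux `CoaxialWallLaw`, stmt-Ventures-19481; lane F v8 `JunkCapBound`)

HONEST FRAMING. Venture `Summits/Ventures/Crystal3D` (cell `crystal3d-full`); an elementary cap-packing lemma `--supports` the crux `CoaxialWallLaw`
(stmt-Ventures-19481, `route-Ventures-StickyWulffConstant`), line 'Certificates' v8/v8.1, analytic input `JunkCapBound` of `stub_incoherentSeamSmall`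
('…SeamIncoherentAssembly'): the CAP TABLE row «the nine slots of the closed lower half-dozen AND one hcp capper (`basalMirror (slotSite 1)`) occupied» — the
pattern of a core ball on a coherent TWIN step (19481-p2 g11 '…HealCapTen' is the sibling row «nine + one upper fcc slot»).
THE FACT.  In cubic coordinates (`c = √2/2`) the hcp capper `t₁ = (−c/3, c/3, 4c/3)` gives `−x₀ + x₁ + 4x₂ ≤ 3c`; with the axial bound
`−x₀+x₁+x₂ ≥ 2c` this yields `0 ≤ x₂ ≤ c/3`, and for two such directions
`⟪u,u'⟫ = (S S' + D D')/2 + x₂x₂' ≥ ((2c−x₂)(2c−x₂') − c²)/2 + x₂x₂' = 1/2 + (c/2)(a+a') + (3/2)a a'` (`S = −x₀+x₁ ≥ 2c − x₂`, `|D| = |x₀+x₁| ≤ c`,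
`a = c/3 − x₂ ≥ 0`): so `⟪u,u'⟫ ≤ 1/2` forces `x₂ = x₂' = c/3`, `S = S' = 5c/3`, `{D, D'} = {c, −c}` — **the two directions ARE the other two hcp tips**
`basalMirror (slotSite 5) = (−c/3, 4c/3, c/3)` and `basalMirror (slotSite 11) = (−4c/3, c/3, c/3)`.  Numerics (19481-p1 g17 calc/healcap_ten.py «TEN′»):
one off-tip direction exists (slack `0.074`), two only at the tips — row `1`.

* `hcp_pair_of_ten'` (vector form), `further_contacts_of_ten'` (packing form), `card_offTip_contacts_le_one_of_ten'`.
WHAT THIS IS NOT: no statement about pools or the stub; F-C1 not moved.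
-/

noncomputable section

namespace Summit.Ventures.Crystal3D.Theorems

namespace TailResidue

open Summit.Ventures.Crystal3D Finset NearIdentity
open Literature.MathematicalPhysics.StatisticalMechanics (basalMirror)
open scoped InnerProductSpace

/-- Cubic coordinates of the three hcp tips `basalMirror (slotSite 1 / 5 / 11)`. -/
theorem cubicCoords_hcpTips :
    cubicCoords (basalMirror (slotSite 1)) = ![-(Real.sqrt 2 / 2) / 3, Real.sqrt 2 / 2 / 3, 4 * (Real.sqrt 2 / 2) / 3] ∧
    cubicCoords (basalMirror (slotSite 5)) = ![-(Real.sqrt 2 / 2) / 3, 4 * (Real.sqrt 2 / 2) / 3, Real.sqrt 2 / 2 / 3] ∧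
    cubicCoords (basalMirror (slotSite 11)) = ![-(4 * (Real.sqrt 2 / 2)) / 3, Real.sqrt 2 / 2 / 3, Real.sqrt 2 / 2 / 3] := by
  have hs : 0 < Real.sqrt 2 := by positivity
  have h2 : Real.sqrt 2 * Real.sqrt 2 = 2 := Real.mul_self_sqrt (by norm_num)
  refine ⟨?_, ?_, ?_⟩ <;>
    (rw [cubicCoords_basalMirror, cubicCoords_slotSite]; ext i; fin_cases i <;> simp [slotVec, slotInt] <;> field_simp <;> nlinarith)

/-- The hcp constraint in cubic coordinates: `⟪u, t₁⟫ ≤ 1/2` gives `−x₀ + x₁ + 4x₂ ≤ 3c`. -/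
theorem hcp_constraint {u : EuclideanSpace ℝ (Fin 3)} (h : ⟪u, basalMirror (slotSite 1)⟫_ℝ ≤ 1 / 2) :
    -cubicCoords u 0 + cubicCoords u 1 + 4 * cubicCoords u 2 ≤ 3 * (Real.sqrt 2 / 2) := by
  obtain ⟨hm1, -, -⟩ := cubicCoords_hcpTips
  have hc0 : 0 < Real.sqrt 2 / 2 := by positivity
  have hcc : (Real.sqrt 2 / 2) * (Real.sqrt 2 / 2) = 1 / 2 := by
    have h2 : Real.sqrt 2 * Real.sqrt 2 = 2 := Real.mul_self_sqrt (by norm_num)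
    nlinarith
  rw [inner_eq_cubicCoords_three, hm1] at h
  simp only [Matrix.cons_val_zero, Matrix.cons_val_one, Matrix.cons_val] at h
  have h' : (Real.sqrt 2 / 2) * (-cubicCoords u 0 + cubicCoords u 1 + 4 * cubicCoords u 2) ≤ 3 / 2 := by nlinarith
  by_contra hgt
  push Not at hgt
  have := mul_lt_mul_of_pos_left hgt hc0
  nlinarith

/-- **Real-variable core of the TEN′ row.**  With `c² = 1/2`: if `0 ≤ rᵢ ≤ c/3`, `2c − rᵢ ≤ Sᵢ`, `|Dᵢ| ≤ c` (`i = 1,2`) and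
`(S₁S₂ + D₁D₂)/2 + r₁r₂ ≤ 1/2`, then `r₁ = r₂ = c/3`, `S₁ = S₂ = 5c/3` and `{D₁, D₂} = {c, −c}`. -/
theorem ten'_core {c S₁ D₁ r₁ S₂ D₂ r₂ : ℝ} (hc0 : 0 < c) (hcc : c * c = 1 / 2)
    (hr₁ : 0 ≤ r₁) (hr₁' : r₁ ≤ c / 3) (hr₂ : 0 ≤ r₂) (hr₂' : r₂ ≤ c / 3) (hS₁ : 2 * c - r₁ ≤ S₁) (hS₂ : 2 * c - r₂ ≤ S₂)
    (hD₁ : -c ≤ D₁) (hD₁' : D₁ ≤ c) (hD₂ : -c ≤ D₂) (hD₂' : D₂ ≤ c) (hI : (S₁ * S₂ + D₁ * D₂) / 2 + r₁ * r₂ ≤ 1 / 2) :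
    r₁ = c / 3 ∧ r₂ = c / 3 ∧ S₁ = 5 * c / 3 ∧ S₂ = 5 * c / 3 ∧ ((D₁ = c ∧ D₂ = -c) ∨ (D₁ = -c ∧ D₂ = c)) := by
  have hSS : (2 * c - r₁) * (2 * c - r₂) ≤ S₁ * S₂ := mul_le_mul hS₁ hS₂ (by linarith) (by linarith)
  have p1 : 0 ≤ (c - D₁) * (c - D₂) := mul_nonneg (by linarith) (by linarith)
  have p2 : 0 ≤ (c + D₁) * (c + D₂) := mul_nonneg (by linarith) (by linarith)
  have e1 : (c - D₁) * (c - D₂) + (c + D₁) * (c + D₂) = 2 * (c * c) + 2 * (D₁ * D₂) := by ring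
  have hDD : -(1 / 2 : ℝ) ≤ D₁ * D₂ := by linarith
  -- slack `(c/2)(a₁+a₂) + (3/2)a₁a₂ ≤ 0` with `aᵢ = c/3 − rᵢ ≥ 0`
  have e2 : (2 * c - r₁) * (2 * c - r₂) = 4 * (c * c) - 2 * (c * r₁) - 2 * (c * r₂) + r₁ * r₂ := by ring
  have e3 : (c / 2) * ((c / 3 - r₁) + (c / 3 - r₂)) + 3 / 2 * ((c / 3 - r₁) * (c / 3 - r₂)) =
      (c * c) / 2 - (c * r₁) - (c * r₂) + 3 / 2 * (r₁ * r₂) := by ring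
  have ha₁ : 0 ≤ c / 3 - r₁ := by linarith
  have ha₂ : 0 ≤ c / 3 - r₂ := by linarith
  have hprod : 0 ≤ (c / 3 - r₁) * (c / 3 - r₂) := mul_nonneg ha₁ ha₂
  have hslack : (c / 2) * ((c / 3 - r₁) + (c / 3 - r₂)) + 3 / 2 * ((c / 3 - r₁) * (c / 3 - r₂)) ≤ 0 := by
    rw [e3]; linarith
  have hsum : (c / 3 - r₁) + (c / 3 - r₂) ≤ 0 := by
    by_contra hgt
    push Not at hgt
    have := mul_pos (by positivity : (0 : ℝ) < c / 2) hgt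
    linarith
  have r₁e : r₁ = c / 3 := by linarith
  have r₂e : r₂ = c / 3 := by linarith
  subst r₁e r₂e
  have hS₁' : 5 * c / 3 ≤ S₁ := by linarith
  have hS₂' : 5 * c / 3 ≤ S₂ := by linarith
  have hSS' : (5 * c / 3) * (5 * c / 3) ≤ S₁ * S₂ := mul_le_mul hS₁' hS₂' (by positivity) (by linarith)
  have e4 : (5 * c / 3) * (5 * c / 3) = 25 * (c * c) / 9 := by ring
  have e5 : c / 3 * (c / 3) = (c * c) / 9 := by ring
  have hSSe : S₁ * S₂ = (5 * c / 3) * (5 * c / 3) := by rw [e4]; rw [e4] at hSS'; rw [e5] at hI; linarith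
  have hDDe : D₁ * D₂ = -(1 / 2) := by rw [e4] at hSS'; rw [e5] at hI; linarith
  have hS₁e : S₁ = 5 * c / 3 := by
    by_contra hne
    have hgt : 5 * c / 3 < S₁ := lt_of_le_of_ne hS₁' (Ne.symm hne)
    have := mul_lt_mul hgt hS₂' (by positivity) (by linarith)
    linarith
  have hS₂e : S₂ = 5 * c / 3 := by
    by_contra hne
    have hgt : 5 * c / 3 < S₂ := lt_of_le_of_ne hS₂' (Ne.symm hne)
    have := mul_lt_mul' hS₁' hgt (by positivity) (by linarith)
    linarith
  refine ⟨rfl, rfl, hS₁e, hS₂e, ?_⟩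
  have hs : (c - D₁) * (c - D₂) + (c + D₁) * (c + D₂) = 0 := by linear_combination 2 * hcc + 2 * hDDe
  have p1z : (c - D₁) * (c - D₂) = 0 := by linarith
  rcases mul_eq_zero.1 p1z with h | h
  · have hD : D₁ = c := by linarith
    left; refine ⟨hD, ?_⟩
    have : c * (D₂ + c) = 0 := by rw [hD] at hDDe; linear_combination hDDe + hcc
    rcases mul_eq_zero.1 this with h' | h'
    · exact absurd h' (ne_of_gt hc0)
    · linarith
  · have hD : D₂ = c := by linarith
    right; refine ⟨?_, hD⟩
    have : c * (D₁ + c) = 0 := by rw [hD] at hDDe; linear_combination hDDe + hcc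
    rcases mul_eq_zero.1 this with h' | h'
    · exact absurd h' (ne_of_gt hc0)
    · linarith

/-- Per-direction data of the TEN′ pattern in cubic coordinates: `0 ≤ x₂ ≤ c/3`, `2c − x₂ ≤ −x₀ + x₁`, `|x₀ + x₁| ≤ c`. -/
theorem ten'_coords {u : EuclideanSpace ℝ (Fin 3)} (h : HealFree u) (ht : ⟪u, basalMirror (slotSite 1)⟫_ℝ ≤ 1 / 2) :
    0 ≤ cubicCoords u 2 ∧ cubicCoords u 2 ≤ Real.sqrt 2 / 2 / 3 ∧
    2 * (Real.sqrt 2 / 2) - cubicCoords u 2 ≤ -cubicCoords u 0 + cubicCoords u 1 ∧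
    -(Real.sqrt 2 / 2) ≤ cubicCoords u 0 + cubicCoords u 1 ∧ cubicCoords u 0 + cubicCoords u 1 ≤ Real.sqrt 2 / 2 := by
  have hA := h.axis_ge
  obtain ⟨a01, a02, a12, -, -, -⟩ := h.constraints
  have htc := hcp_constraint ht
  obtain ⟨d1, d2⟩ := abs_le.1 a01
  have e1 := (abs_le.1 a02).1
  have e2 := (abs_le.1 a12).2
  exact ⟨by linarith, by linarith, by linarith, d1, d2⟩

/-- **TEN′, vector form**: two heal-free directions, each at inner product `≤ 1/2` with the hcp tip `basalMirror (slotSite 1)`, at mutual inner product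
`≤ 1/2`, ARE the two other hcp tips. -/
theorem hcp_pair_of_ten' {u₁ u₂ : EuclideanSpace ℝ (Fin 3)} (h₁ : HealFree u₁) (h₂ : HealFree u₂)
    (h₁t : ⟪u₁, basalMirror (slotSite 1)⟫_ℝ ≤ 1 / 2) (h₂t : ⟪u₂, basalMirror (slotSite 1)⟫_ℝ ≤ 1 / 2) (h₁₂ : ⟪u₁, u₂⟫_ℝ ≤ 1 / 2) :
    (u₁ = basalMirror (slotSite 5) ∧ u₂ = basalMirror (slotSite 11)) ∨ (u₁ = basalMirror (slotSite 11) ∧ u₂ = basalMirror (slotSite 5)) := by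
  have hc0 : 0 < Real.sqrt 2 / 2 := by positivity
  have hcc : (Real.sqrt 2 / 2) * (Real.sqrt 2 / 2) = 1 / 2 := by
    have h2 : Real.sqrt 2 * Real.sqrt 2 = 2 := Real.mul_self_sqrt (by norm_num)
    nlinarith
  obtain ⟨r₁ge, r₁le, hS₁, hD₁, hD₁'⟩ := ten'_coords h₁ h₁t
  obtain ⟨r₂ge, r₂le, hS₂, hD₂, hD₂'⟩ := ten'_coords h₂ h₂t
  have hI : cubicCoords u₁ 0 * cubicCoords u₂ 0 + cubicCoords u₁ 1 * cubicCoords u₂ 1 + cubicCoords u₁ 2 * cubicCoords u₂ 2 ≤ 1 / 2 := by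
    rw [← inner_eq_cubicCoords_three]; exact h₁₂
  have hI' : ((-cubicCoords u₁ 0 + cubicCoords u₁ 1) * (-cubicCoords u₂ 0 + cubicCoords u₂ 1) +
      (cubicCoords u₁ 0 + cubicCoords u₁ 1) * (cubicCoords u₂ 0 + cubicCoords u₂ 1)) / 2 + cubicCoords u₁ 2 * cubicCoords u₂ 2 ≤ 1 / 2 := by
    have hid : cubicCoords u₁ 0 * cubicCoords u₂ 0 + cubicCoords u₁ 1 * cubicCoords u₂ 1 =
        ((-cubicCoords u₁ 0 + cubicCoords u₁ 1) * (-cubicCoords u₂ 0 + cubicCoords u₂ 1) +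
          (cubicCoords u₁ 0 + cubicCoords u₁ 1) * (cubicCoords u₂ 0 + cubicCoords u₂ 1)) / 2 := by ring
    linarith
  have c3 : Real.sqrt 2 / 2 / 3 = (Real.sqrt 2 / 2) / 3 := rfl
  obtain ⟨r₁e, r₂e, S₁e, S₂e, hD⟩ := ten'_core hc0 hcc r₁ge r₁le r₂ge r₂le hS₁ hS₂ hD₁ hD₁' hD₂ hD₂' hI'
  obtain ⟨-, hm5, hm11⟩ := cubicCoords_hcpTips
  have mk : ∀ {v : EuclideanSpace ℝ (Fin 3)} {w : EuclideanSpace ℝ (Fin 3)} {a b e : ℝ}, cubicCoords w = ![a, b, e] →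
      cubicCoords v 0 = a → cubicCoords v 1 = b → cubicCoords v 2 = e → v = w := by
    intro v w a b e hw h0 h1 h2
    apply cubicCoords_injective; rw [hw]; ext i; fin_cases i
    · exact h0
    · exact h1
    · exact h2
  rcases hD with ⟨d₁, d₂⟩ | ⟨d₁, d₂⟩
  · left
    exact ⟨mk hm5 (by linarith) (by linarith) (by linarith), mk hm11 (by linarith) (by linarith) (by linarith)⟩
  · right
    exact ⟨mk hm11 (by linarith) (by linarith) (by linarith), mk hm5 (by linarith) (by linarith) (by linarith)⟩

/-! ### Packing forms -/

open scoped Classical in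
/-- **TEN′, packing form**: in a `1`-separated configuration let `y` have the nine closed-lower-half positions `y + L(slotSite k)`, `k ∈ lowerNine`, AND the
hcp capper `y + L(basalMirror (slotSite 1))` occupied.  Two DISTINCT further contacts of `y` (not among those ten balls) sit exactly at the two other hcp
tips `y + L(basalMirror (slotSite 5))`, `y + L(basalMirror (slotSite 11))`. -/
theorem further_contacts_of_ten' {X : Finset (EuclideanSpace ℝ (Fin 3))} (hX : ∀ p ∈ X, ∀ q ∈ X, p ≠ q → 1 ≤ dist p q)
    (L : EuclideanSpace ℝ (Fin 3) ≃ₗᵢ[ℝ] EuclideanSpace ℝ (Fin 3)) {y x x' : EuclideanSpace ℝ (Fin 3)}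
    (hocc : ∀ k ∈ lowerNine, y + L (slotSite k) ∈ X) (hocct : y + L (basalMirror (slotSite 1)) ∈ X)
    (hx : x ∈ X) (hd : dist y x = 1) (hne : ∀ k ∈ lowerNine, x ≠ y + L (slotSite k)) (hnet : x ≠ y + L (basalMirror (slotSite 1)))
    (hx' : x' ∈ X) (hd' : dist y x' = 1) (hne' : ∀ k ∈ lowerNine, x' ≠ y + L (slotSite k)) (hnet' : x' ≠ y + L (basalMirror (slotSite 1)))
    (hxx : x ≠ x') :
    (x = y + L (basalMirror (slotSite 5)) ∧ x' = y + L (basalMirror (slotSite 11))) ∨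
      (x = y + L (basalMirror (slotSite 11)) ∧ x' = y + L (basalMirror (slotSite 5))) := by
  have hf := healFree_of_contact hX L hocc hx hd hne
  have hf' := healFree_of_contact hX L hocc hx' hd' hne'
  have hxy : ‖x - y‖ = 1 := by rw [← dist_eq_norm, dist_comm]; exact hd
  have hxy' : ‖x' - y‖ = 1 := by rw [← dist_eq_norm, dist_comm]; exact hd'
  have ht1 : ‖basalMirror (slotSite 1)‖ = 1 := by
    have hmem : basalMirror (slotSite 1) ∈ healTips := by simp [healTips]
    have := cubicCoords_sq_sum (u := slotSite 1) (norm_eq_one_of_mem_fccSlots (slotSite_mem 1))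
    obtain ⟨hm1, -, -⟩ := cubicCoords_hcpTips
    have hsq := norm_sq_eq_cubicCoords (basalMirror (slotSite 1))
    rw [hm1] at hsq
    simp only [dotProduct, Fin.sum_univ_three, Matrix.cons_val_zero, Matrix.cons_val_one, Matrix.cons_val] at hsq
    have h2 : Real.sqrt 2 * Real.sqrt 2 = 2 := Real.mul_self_sqrt (by norm_num)
    have h1 : ‖basalMirror (slotSite 1)‖ ^ 2 = 1 := by rw [hsq]; nlinarith
    have hn := norm_nonneg (basalMirror (slotSite 1))
    nlinarith
  have tip : ∀ {w}, w ∈ X → ‖w - y‖ = 1 → w ≠ y + L (basalMirror (slotSite 1)) → ⟪L.symm (w - y), basalMirror (slotSite 1)⟫_ℝ ≤ 1 / 2 := by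
    intro w hw hwy hnew
    have h1 : ⟪L.symm (w - y), basalMirror (slotSite 1)⟫_ℝ = ⟪w - y, L (basalMirror (slotSite 1))⟫_ℝ := by
      rw [← L.inner_map_map (L.symm (w - y)) (basalMirror (slotSite 1)), LinearIsometryEquiv.apply_symm_apply]
    rw [h1]
    refine inner_le_half_of_norm_sub_ge_one hwy (by rw [LinearIsometryEquiv.norm_map]; exact ht1) ?_
    have : w - y - L (basalMirror (slotSite 1)) = w - (y + L (basalMirror (slotSite 1))) := by abel
    rw [this, ← dist_eq_norm]
    exact hX w hw _ hocct hnew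
  have hin : ⟪L.symm (x - y), L.symm (x' - y)⟫_ℝ ≤ 1 / 2 := by
    rw [L.symm.inner_map_map]
    refine inner_le_half_of_norm_sub_ge_one hxy hxy' ?_
    have : x - y - (x' - y) = x - x' := by abel
    rw [this, ← dist_eq_norm]; exact hX x hx x' hx' hxx
  have back : ∀ {w} {t : EuclideanSpace ℝ (Fin 3)}, L.symm (w - y) = t → w = y + L t := by
    intro w t h
    have : w - y = L t := by rw [← h, LinearIsometryEquiv.apply_symm_apply]
    rw [← this]; abel
  rcases hcp_pair_of_ten' hf hf' (tip hx hxy hnet) (tip hx' hxy' hnet') hin with ⟨a, b⟩ | ⟨a, b⟩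
  · exact Or.inl ⟨back a, back b⟩
  · exact Or.inr ⟨back a, back b⟩

open scoped Classical in
/-- **Cap-table row «TEN′»**: a ball with its closed lower half-dozen and one hcp capper occupied has AT MOST ONE contact off those ten balls and off the two
other hcp tips. -/
theorem card_offTip_contacts_le_one_of_ten' {X : Finset (EuclideanSpace ℝ (Fin 3))} (hX : ∀ p ∈ X, ∀ q ∈ X, p ≠ q → 1 ≤ dist p q)
    (L : EuclideanSpace ℝ (Fin 3) ≃ₗᵢ[ℝ] EuclideanSpace ℝ (Fin 3)) {y : EuclideanSpace ℝ (Fin 3)}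
    (hocc : ∀ k ∈ lowerNine, y + L (slotSite k) ∈ X) (hocct : y + L (basalMirror (slotSite 1)) ∈ X) :
    (X.filter fun x => dist y x = 1 ∧ (∀ k ∈ lowerNine, x ≠ y + L (slotSite k)) ∧ x ≠ y + L (basalMirror (slotSite 1)) ∧
      x ≠ y + L (basalMirror (slotSite 5)) ∧ x ≠ y + L (basalMirror (slotSite 11))).card ≤ 1 := by
  refine card_le_one.2 fun a ha b hb => ?_
  simp only [mem_filter] at ha hb
  by_contra hab
  rcases further_contacts_of_ten' hX L hocc hocct ha.1 ha.2.1 ha.2.2.1 ha.2.2.2.1 hb.1 hb.2.1 hb.2.2.1 hb.2.2.2.1 hab with ⟨h, -⟩ | ⟨h, -⟩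
  · exact ha.2.2.2.2.1 h
  · exact ha.2.2.2.2.2 h

end TailResidue

end Summit.Ventures.Crystal3D.Theorems

end
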